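import Summits.NavierStokesRegularity.NavierStokesRegularity.Theorems.FastClassSqueeze.Negative.KinematicBlob

/-!
# `FastClassSqueeze` is not kinematic, part 2/2: the fast biaxial core and the refutation

Negative-side support for the crux `FastClassSqueeze` (stmt-NavierStokesRegularity-15832, route
`HodographBetchov`, rank 3), refuter crux-disprover cycle 1 (2026-08-17). Theorems and an explicit
witness only; nothing here asserts a Theses statement.

The crux asks, along every classical Leray–Hopf solution on `[0,T)`, for a level `l > 0`, an exponent
`q > 3/2` and a nonnegative min–max majorant `m` of the middle strain eigenvalue on the fast class
`{|u(t)| > l}` with `∫₀ᵀ (∫_{|u|>l} m^q)^{2/(2q−3)} < ∞`. The landed `FalseWithoutLerayHopf`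
(p150219) shows that the energy class is load-bearing; this file shows that the energy class is NOT
ENOUGH either: **the conclusion is not a kinematic–energetic fact.**

`fastClassSqueeze_false_kinematic`: it is FALSE that the conclusion of the crux holds for every
jointly smooth, divergence-free field on `[0,T) × ℝ³` with compactly supported slices, finite and
NON-INCREASING energy, FINITE total dissipation `∫₀ᵀ∫|∇u|² < ∞`, the TYPE-I (self-similar) rate
`‖u(t)‖_∞ ≤ M (T−t)^{-1/2}` and a BOUNDED CRITICAL NORM `sup_t ∫|u(t)|³ < ∞` (the
Escauriaza–Seregin–Šverák class `L^∞_t L³_x`, `blob_critical`: the critical norm of the blob is scale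
invariant) — i.e. for every field carrying all the a-priori information a Leray–Hopf classical flow
is known to carry, but not the equation. (For actual Navier–Stokes flows the `L^∞_t L³_x` bound alone
already gives regularity by ESS backward uniqueness — exactly the kind of DYNAMIC input a proof of
the crux must use.)

Witness (`T = 1`, built in part 1/2 `KinematicBlob.lean`): the self-similar-rate collapsing blob `u(t, x) = λ U(λ x)`, `λ(t) = (1 − t)^{-1/2}`
(`blob`, `rate`), with biaxProfile `U = curl (χ A)` (`biaxProfile`), `A(x) = (x₁x₂, −x₀x₂, 0)` (`quadPot`,
`curl A = (x₀, x₁, −2x₂) = B x`, `curl_quadPot`) and `χ` a `ContDiffBump` equal to `1` on the unit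
ball (`cutoff`): `U` is smooth, compactly supported, divergence free (`div curl = 0`,
`divergence_curl_eq_zero_holds`) and `U = B = diag(1,1,−2)` on the unit ball (`biaxProfile_of_mem_ball`).
* energy `∫|u(t)|² = λ⁻¹ ∫|U|² = √(1−t) ∫|U|²` is finite and decreasing (`lintegral_blobSlice_sq`,
  `blob_energy_antitone`); dissipation `∫₀¹∫|∇u|² = ∫₀¹ λ · ∫|∇U|² < ∞` (`blob_dissipation_lt_top`,
  `λ = (1−t)^{-1/2}` integrable); speed `‖u(t)‖ ≤ ‖U‖_∞ (1−t)^{-1/2}` (`blob_typeI`);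
* but on the fast biaxial CORE `B((2λ)⁻¹e₀, (4λ)⁻¹)` — inside `B(0, λ⁻¹)`, where `u(t) = λ² B` is
  linear (`blobSlice_eq_of_norm_lt`) and fast once `λ ≥ 4l` (`core_fast`) — the min–max clause forces
  `m ≥ λ²` (`core_le_majorant`, via `le_of_plane` of FalseWithoutLerayHopf: the middle eigenvalue of
  `λ² diag(1,1,−2)` is `+λ²`), so `∫_{|u|>l} m^q ≥ (λ²)^q |core| = (λ²)^q 4⁻³λ⁻³ |B₁|`
  (`core_inner_lower`), whose `2/(2q−3)`-th power is `λ² · K`, `K = (4⁻³|B₁|)^{2/(2q−3)} > 0`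
  (`core_rpow_identity`: the exponent bookkeeping `(2q−3)·2/(2q−3) = 2`), i.e. `K/(1−t)`; and
  `∫^1 dt/(1−t) = ∞` (`lintegral_inv_one_sub_eq_top`).

Information for provers: (i) any proof of the crux must use the momentum equation beyond the energy
inequality (pressure / local energy flux through the isotachs `{|u| = l}`); (ii) what must be
excluded is exactly the FAST BIAXIAL TYPE-I COLLAPSE — `λ₂ > 0` on fluid moving at the top speed,
concentrating at the self-similar rate — and the self-similar rate is the first (logarithmically)
divergent one, so the crux contains the exclusion of (fast, biaxial) Type-I blow-up; (iii) slower
collapses (`∫λ² < ∞`) are harmless, faster ones are excluded by the Type-I hypothesis here but not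
by the crux. Companion: `Cruxes/FastClassSqueeze/Disproof.lean` §5.
[cite: MajdaBertozzi2002, §1.4 (exact solutions with linear velocity field)]
-/

noncomputable section

-- the summit and its single problem share the name `NavierStokesRegularity` (D-0017 nested layout)
set_option linter.dupNamespace false

namespace Summit.NavierStokesRegularity.NavierStokesRegularity.Theorems.FastClassSqueeze.Negative

open MeasureTheory Set Filter Metric Topology Function InnerProductSpace
open scoped ENNReal NNReal RealInnerProductSpace ContDiff
open Literature.Analysis.FluidPDE

/-! ## The critical norm: the witness lies in the ESS class `L^∞_t L³_x` -/

/-- **The critical norm of the slices is scale invariant**: `∫ |c U(c x)|³ dx = ∫ |U|³` (`c > 0`).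
[folklore] -/
theorem lintegral_blobSlice_cube {c : ℝ} (hc : 0 < c) :
    ∫⁻ x, ‖blobSlice c x‖ₑ ^ 3 = ∫⁻ x, ‖biaxProfile x‖ₑ ^ 3 := by
  have h1 : ∀ x, ‖blobSlice c x‖ₑ ^ 3 = ENNReal.ofReal (c ^ 3) * ‖biaxProfile (c • x)‖ₑ ^ 3 := by
    intro x
    rw [blobSlice, enorm_smul, mul_pow, Real.enorm_eq_ofReal hc.le, ENNReal.ofReal_pow hc.le]
  simp_rw [h1]
  rw [lintegral_const_mul' _ _ ENNReal.ofReal_ne_top,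
    HomSobolevSymmetry.lintegral_comp_smul (fun x => ‖biaxProfile x‖ₑ ^ 3) hc, ← mul_assoc,
    ← ENNReal.ofReal_mul (by positivity), mul_inv_cancel₀ (by positivity), ENNReal.ofReal_one,
    one_mul]

/-- The profile has finite critical norm `∫ |U|³ < ∞`. [folklore] -/
theorem lintegral_biaxProfile_cube_lt_top :
    ∫⁻ x, ‖biaxProfile x‖ₑ ^ 3 < ⊤ := by
  have h : MemLp biaxProfile 3 (volume : Measure (EuclideanSpace ℝ (Fin 3))) :=
    (contDiff_biaxProfile (n := 0)).continuous.memLp_of_hasCompactSupport hasCompactSupport_biaxProfile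
  have := lintegral_rpow_enorm_lt_top_of_eLpNorm_lt_top (by norm_num) ENNReal.ofNat_ne_top
    h.eLpNorm_lt_top
  simpa [ENNReal.toReal_ofNat] using this

/-- **The witness stays bounded in the critical space `L³`** (the Escauriaza–Seregin–Šverák class
`L^∞_t L³_x`): `∫ |u(t)|³ = ∫ |U|³` for all `t < 1`. [folklore] -/
theorem blob_critical :
    ∃ C : ℝ≥0∞, C < ⊤ ∧ ∀ t ∈ Ico (0 : ℝ) 1, ∫⁻ x, ‖blob t x‖ₑ ^ 3 ≤ C :=
  ⟨∫⁻ x, ‖biaxProfile x‖ₑ ^ 3, lintegral_biaxProfile_cube_lt_top, fun t ht =>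
    (lintegral_blobSlice_cube (c := rate t) (rate_pos ht.2)).le⟩

/-! ## The fast biaxial core: where the min–max clause forces `m ≥ λ²` -/

/-- Centre `(2c)⁻¹ e₀` of the core ball at dilation `c`. -/
def coreCentre (c : ℝ) : EuclideanSpace ℝ (Fin 3) := (2⁻¹ * c⁻¹) • ex

/-- `‖(2c)⁻¹ e₀‖ = (2c)⁻¹`. [folklore] -/
theorem norm_coreCentre {c : ℝ} (hc : 0 < c) : ‖coreCentre c‖ = 2⁻¹ * c⁻¹ := by
  rw [coreCentre, norm_smul, Real.norm_eq_abs, abs_of_pos (by positivity)]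
  simp [ex]

/-- Points of the core ball `B((2c)⁻¹e₀, (4c)⁻¹)` satisfy `(4c)⁻¹ < ‖y‖ < c⁻¹`. [folklore] -/
theorem norm_bounds_of_mem_core {c : ℝ} (hc : 0 < c) {y : EuclideanSpace ℝ (Fin 3)}
    (hy : y ∈ ball (coreCentre c) (4⁻¹ * c⁻¹)) : 4⁻¹ * c⁻¹ < ‖y‖ ∧ ‖y‖ < c⁻¹ := by
  have h1 : ‖y - coreCentre c‖ < 4⁻¹ * c⁻¹ := by rwa [mem_ball, dist_eq_norm] at hy
  have h2 := norm_coreCentre hc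
  have h3 : ‖coreCentre c‖ - ‖y‖ ≤ ‖y - coreCentre c‖ := by
    rw [norm_sub_rev]; exact norm_sub_norm_le _ _
  have h4 : ‖y‖ ≤ ‖coreCentre c‖ + ‖y - coreCentre c‖ := norm_le_insert' _ _
  have h5 : 0 < c⁻¹ := inv_pos.2 hc
  constructor <;> nlinarith

/-- **On `B(0, c⁻¹)` the slice is the linear map `c² B`** (there `c x` lies in the unit ball, where
`U = B`). [folklore] -/
theorem blobSlice_eq_of_norm_lt {c : ℝ} (hc : 0 < c) {y : EuclideanSpace ℝ (Fin 3)} (hy : ‖y‖ < c⁻¹) :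
    blobSlice c y = ((c * c) • strainB) y := by
  have h1 : c • y ∈ ball (0 : EuclideanSpace ℝ (Fin 3)) 1 := by
    rw [mem_ball_zero_iff, norm_smul, Real.norm_eq_abs, abs_of_pos hc]
    calc c * ‖y‖ < c * c⁻¹ := mul_lt_mul_of_pos_left hy hc
      _ = 1 := mul_inv_cancel₀ hc.ne'
  show c • biaxProfile (c • y) = (c * c) • strainB y
  rw [biaxProfile_of_mem_ball h1, map_smul, smul_smul]

/-- `∇(slice) = c² B` on `B(0, c⁻¹)`. [folklore] -/
theorem fderiv_blobSlice_of_norm_lt {c : ℝ} (hc : 0 < c) {y : EuclideanSpace ℝ (Fin 3)}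
    (hy : ‖y‖ < c⁻¹) : fderiv ℝ (blobSlice c) y = (c * c) • strainB := by
  have h : blobSlice c =ᶠ[𝓝 y] ⇑((c * c) • strainB) := by
    have ho : IsOpen {z : EuclideanSpace ℝ (Fin 3) | ‖z‖ < c⁻¹} := isOpen_lt continuous_norm continuous_const
    filter_upwards [ho.mem_nhds hy] with z hz
    exact blobSlice_eq_of_norm_lt hc hz
  rw [h.fderiv_eq, ContinuousLinearMap.fderiv]

/-- **The core is fast**: for `4l ≤ c`, every point of the core ball has speed `> l`
(`|c² B y| ≥ c²‖y‖ > c²(4c)⁻¹ = c/4 ≥ l`). [folklore] -/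
theorem core_fast {c l : ℝ} (hc : 0 < c) (hcl : 4 * l ≤ c) {y : EuclideanSpace ℝ (Fin 3)}
    (hy : y ∈ ball (coreCentre c) (4⁻¹ * c⁻¹)) : l < ‖blobSlice c y‖ := by
  obtain ⟨h1, h2⟩ := norm_bounds_of_mem_core hc hy
  rw [blobSlice_eq_of_norm_lt hc h2]
  show l < ‖(c * c) • strainB y‖
  rw [norm_smul, Real.norm_eq_abs, abs_of_pos (mul_pos hc hc)]
  calc l ≤ c * 4⁻¹ := by linarith
    _ = (c * c) * (4⁻¹ * c⁻¹) := by field_simp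
    _ < (c * c) * ‖y‖ := mul_lt_mul_of_pos_left h1 (mul_pos hc hc)
    _ ≤ (c * c) * ‖strainB y‖ := mul_le_mul_of_nonneg_left (norm_le_norm_strainB y) (mul_pos hc hc).le

/-- **The min–max clause forces `m ≥ c²` on the core** (the middle eigenvalue of `c² diag(1,1,−2)` is
`+c²`: `le_of_plane`). [folklore] -/
theorem core_le_majorant {c m : ℝ} (hc : 0 < c) {y : EuclideanSpace ℝ (Fin 3)}
    (hy : y ∈ ball (coreCentre c) (4⁻¹ * c⁻¹))
    (h : ∃ v w : EuclideanSpace ℝ (Fin 3), ‖v‖ = 1 ∧ ‖w‖ = 1 ∧ ⟪v, w⟫ = 0 ∧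
      ∀ α β : ℝ, ⟪fderiv ℝ (blobSlice c) y (α • v + β • w), α • v + β • w⟫ ≤ m * (α ^ 2 + β ^ 2)) :
    c * c ≤ m := by
  rw [fderiv_blobSlice_of_norm_lt hc (norm_bounds_of_mem_core hc hy).2, ← fderiv_biaxVel (c * c) y] at h
  exact le_of_plane h

/-- **Lower bound on the fast-class integral of any admissible majorant** at dilation `c ≥ 4l`:
`(c²)^q · |core ball| ≤ ∫_{|slice| > l} m^q`. [folklore] -/
theorem core_inner_lower {c l q : ℝ} (hc : 0 < c) (hcl : 4 * l ≤ c) (hq : 0 ≤ q)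
    {μ : EuclideanSpace ℝ (Fin 3) → ℝ}
    (hμ : ∀ y, l < ‖blobSlice c y‖ → ∃ v w : EuclideanSpace ℝ (Fin 3), ‖v‖ = 1 ∧ ‖w‖ = 1 ∧ ⟪v, w⟫ = 0 ∧
      ∀ α β : ℝ, ⟪fderiv ℝ (blobSlice c) y (α • v + β • w), α • v + β • w⟫ ≤ μ y * (α ^ 2 + β ^ 2)) :
    ENNReal.ofReal (c * c) ^ q * volume (ball (coreCentre c) (4⁻¹ * c⁻¹)) ≤
      ∫⁻ y in {y : EuclideanSpace ℝ (Fin 3) | l < ‖blobSlice c y‖}, ENNReal.ofReal (μ y) ^ q := by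
  calc ENNReal.ofReal (c * c) ^ q * volume (ball (coreCentre c) (4⁻¹ * c⁻¹))
      = ∫⁻ _ in ball (coreCentre c) (4⁻¹ * c⁻¹), ENNReal.ofReal (c * c) ^ q := (setLIntegral_const _ _).symm
    _ ≤ ∫⁻ y in ball (coreCentre c) (4⁻¹ * c⁻¹), ENNReal.ofReal (μ y) ^ q :=
        setLIntegral_mono' measurableSet_ball fun y hy =>
          ENNReal.rpow_le_rpow
            (ENNReal.ofReal_le_ofReal (core_le_majorant hc hy (hμ y (core_fast hc hcl hy)))) hq
    _ ≤ _ := lintegral_mono_set fun y hy => core_fast hc hcl hy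

/-- The exponent bookkeeping `(2q − 3) · 2/(2q−3) = 2` behind the log-divergence at the
self-similar rate: `((c²)^q (4⁻¹c⁻¹)³)^{2/(2q−3)} = c² · (4⁻³)^{2/(2q−3)}`. [folklore] -/
theorem real_core_identity {c q : ℝ} (hc : 0 < c) (hq : 3 / 2 < q) :
    ((c * c) ^ q * (4⁻¹ * c⁻¹) ^ 3) ^ (2 / (2 * q - 3)) =
      c ^ 2 * ((4 : ℝ)⁻¹ ^ 3) ^ (2 / (2 * q - 3)) := by
  have hq3 : (2 * q - 3) ≠ 0 := by linarith
  have h1 : (c * c) ^ q = c ^ (2 * q) := by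
    rw [← sq, ← Real.rpow_natCast c 2, ← Real.rpow_mul hc.le]
    norm_num
  have h2 : (4⁻¹ * c⁻¹ : ℝ) ^ 3 = (4 : ℝ)⁻¹ ^ 3 * c ^ (-(3 : ℝ)) := by
    have aux : c ^ (3 : ℝ) = c ^ (3 : ℕ) := by exact_mod_cast Real.rpow_natCast c 3
    rw [mul_pow, Real.rpow_neg hc.le, aux, inv_pow, inv_pow]
  have h3 : c ^ (2 * q) * ((4 : ℝ)⁻¹ ^ 3 * c ^ (-(3 : ℝ))) = (4 : ℝ)⁻¹ ^ 3 * c ^ (2 * q - 3) := by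
    rw [mul_left_comm, ← Real.rpow_add hc]
    ring_nf
  have h4 : (c ^ (2 * q - 3)) ^ (2 / (2 * q - 3)) = c ^ 2 := by
    have h5 : (2 * q - 3) * (2 / (2 * q - 3)) = 2 := by field_simp
    rw [← Real.rpow_mul hc.le, h5, Real.rpow_two]
  rw [h1, h2, h3, Real.mul_rpow (by positivity) (Real.rpow_nonneg hc.le _), h4, mul_comm]

/-- **The `2/(2q−3)`-th power of the core lower bound is `λ² ×` a positive constant**:
`((c²)^q |B((2c)⁻¹e₀,(4c)⁻¹)|)^{2/(2q−3)} = c² · ((4⁻³) |B₁|)^{2/(2q−3)}`. [folklore] -/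
theorem core_rpow_identity {c q : ℝ} (hc : 0 < c) (hq : 3 / 2 < q) :
    (ENNReal.ofReal (c * c) ^ q * volume (ball (coreCentre c) (4⁻¹ * c⁻¹))) ^ (2 / (2 * q - 3)) =
      ENNReal.ofReal (c ^ 2) *
        (ENNReal.ofReal ((4 : ℝ)⁻¹ ^ 3) * volume (ball (0 : EuclideanSpace ℝ (Fin 3)) 1)) ^
          (2 / (2 * q - 3)) := by
  have he : 0 ≤ 2 / (2 * q - 3) := (div_pos two_pos (by linarith)).le
  have hcq : 0 ≤ (c * c) ^ q := Real.rpow_nonneg (mul_self_nonneg c) _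
  have h4 : (0 : ℝ) ≤ (4⁻¹ * c⁻¹) ^ 3 := by positivity
  have hA : (ENNReal.ofReal (c * c) ^ q) ^ (2 / (2 * q - 3)) *
      ENNReal.ofReal ((4⁻¹ * c⁻¹) ^ 3) ^ (2 / (2 * q - 3)) =
      ENNReal.ofReal (c ^ 2) * ENNReal.ofReal ((4 : ℝ)⁻¹ ^ 3) ^ (2 / (2 * q - 3)) := by
    rw [ENNReal.ofReal_rpow_of_pos (mul_pos hc hc), ENNReal.ofReal_rpow_of_nonneg hcq he,
      ENNReal.ofReal_rpow_of_nonneg h4 he, ← ENNReal.ofReal_mul (Real.rpow_nonneg hcq _),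
      ← Real.mul_rpow hcq h4, real_core_identity hc hq, ENNReal.ofReal_mul (sq_nonneg c),
      ENNReal.ofReal_rpow_of_nonneg (by positivity) he]
  rw [Measure.addHaar_ball volume (coreCentre c) (by positivity : (0 : ℝ) ≤ 4⁻¹ * c⁻¹),
    finrank_euclideanSpace_fin, ← mul_assoc, ENNReal.mul_rpow_of_nonneg _ _ he,
    ENNReal.mul_rpow_of_nonneg _ _ he, hA, ENNReal.mul_rpow_of_nonneg _ _ he, mul_assoc]

/-- **`∫ₐ¹ dt/(1 − t) = ∞`** (`a < 1`): the logarithmic divergence at the collapse time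
(Mathlib: `(t − 1)⁻¹` is not interval integrable across `1`). [folklore] -/
theorem lintegral_inv_one_sub_eq_top {a : ℝ} (ha : a < 1) :
    ∫⁻ t in Ioo a 1, ENNReal.ofReal ((1 - t)⁻¹) = ⊤ := by
  have hni : ¬ IntegrableOn (fun t : ℝ => (t - 1)⁻¹) (Ioo a 1) := by
    intro h
    have h2 : IntervalIntegrable (fun t : ℝ => (t - 1)⁻¹) volume a 1 :=
      (intervalIntegrable_iff_integrableOn_Ioo_of_le ha.le).2 h
    rw [intervalIntegrable_sub_inv_iff] at h2
    rcases h2 with h2 | h2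
    · exact absurd h2 ha.ne
    · exact h2 right_mem_uIcc
  have hmeas : AEStronglyMeasurable (fun t : ℝ => (t - 1)⁻¹) (volume.restrict (Ioo a 1)) :=
    ((measurable_id.sub_const 1).inv).aestronglyMeasurable
  have htop : ∫⁻ t in Ioo a 1, ‖(t - 1)⁻¹‖ₑ = ⊤ := by
    by_contra hne
    exact hni ⟨hmeas, lt_top_iff_ne_top.2 hne⟩
  rw [← htop]
  refine setLIntegral_congr_fun measurableSet_Ioo fun t ht => ?_
  rw [Real.enorm_eq_ofReal_abs, abs_inv, abs_of_neg (by linarith [ht.2]), neg_sub]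

/-! ## The conclusion of `FastClassSqueeze` is not kinematic -/

/-- **`FastClassSqueeze` does not follow from smoothness, incompressibility, the energy class (finite,
non-increasing energy, finite total dissipation), the Type-I rate and a bounded critical norm
`sup_t ∫|u(t)|³ < ∞` (the Escauriaza–Seregin–Šverák class).** The conclusion of the crux
— a level `l > 0`, an exponent `q > 3/2` and a nonnegative min–max majorant `m` of the middle strain
eigenvalue on the fast class with `∫₀ᵀ (∫_{|u|>l} m^q)^{2/(2q−3)} < ∞` — FAILS for the
self-similar-rate collapsing blob `u(t,x) = λU(λx)`, `λ = (1−t)^{-1/2}`, `U = curl(χ A)` (smooth,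
compactly supported, divergence free, `= diag(1,1,−2)x` on the unit ball): its energy is
`√(1−t) ∫|U|²` (decreasing), its dissipation `∫₀¹ λ ∫|∇U|² < ∞`, its speed `≤ ‖U‖_∞ (1−t)^{-1/2}`,
but on the fast biaxial core `B((2λ)⁻¹e₀, (4λ)⁻¹)` (speed `> l` once `λ ≥ 4l`) the min–max clause
forces `m ≥ λ²`, so the time integrand is `≥ K λ² = K/(1 − t)` with `K > 0`, and `∫ dt/(1−t) = ∞`.
Hence any proof of the crux must use the momentum equation beyond the energy inequality, and must
exclude exactly the FAST BIAXIAL TYPE-I collapse; the self-similar rate is the first (logarithmically)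
divergent one. [folklore] -/
theorem fastClassSqueeze_false_kinematic :
    ¬ (∀ (T : ℝ), 0 < T →
      ∀ (u : ℝ → EuclideanSpace ℝ (Fin 3) → EuclideanSpace ℝ (Fin 3)),
        IsSmoothSpaceTimeOn (Set.Ico 0 T) u →
        (∀ t ∈ Set.Ico 0 T, VectorCalculus.IsDivFree (u t)) →
        (∀ t ∈ Set.Ico 0 T, HasCompactSupport (u t)) →
        (∀ t ∈ Set.Ico 0 T, ∫⁻ x, ‖u t x‖ₑ ^ 2 < ⊤) →
        (∀ s ∈ Set.Ico 0 T, ∀ t ∈ Set.Ico 0 T, s ≤ t → ∫⁻ x, ‖u t x‖ₑ ^ 2 ≤ ∫⁻ x, ‖u s x‖ₑ ^ 2) →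
        (∫⁻ t in Set.Ioo 0 T, ∫⁻ x, ‖fderiv ℝ (u t) x‖ₑ ^ 2 < ⊤) →
        (∃ M : ℝ, ∀ t ∈ Set.Ico 0 T, ∀ x, ‖u t x‖ ≤ M / Real.sqrt (T - t)) →
        (∃ C : ℝ≥0∞, C < ⊤ ∧ ∀ t ∈ Set.Ico 0 T, ∫⁻ x, ‖u t x‖ₑ ^ 3 ≤ C) →
        ∃ l : ℝ, 0 < l ∧ ∃ q : ℝ, 3 / 2 < q ∧ ∃ m : ℝ → EuclideanSpace ℝ (Fin 3) → ℝ,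
          (∀ t x, 0 ≤ m t x) ∧
          (∀ t ∈ Set.Ico 0 T, ∀ x, l < ‖u t x‖ → ∃ v w : EuclideanSpace ℝ (Fin 3),
            ‖v‖ = 1 ∧ ‖w‖ = 1 ∧ inner ℝ v w = 0 ∧
            ∀ α β : ℝ, inner ℝ (fderiv ℝ (u t) x (α • v + β • w)) (α • v + β • w) ≤
              m t x * (α ^ 2 + β ^ 2)) ∧
          ∫⁻ t in Set.Ioo 0 T, (∫⁻ x in {x : EuclideanSpace ℝ (Fin 3) | l < ‖u t x‖},
            ENNReal.ofReal (m t x) ^ q) ^ (2 / (2 * q - 3)) < ⊤) := by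
  intro h
  obtain ⟨l, -, q, hq, m, -, hplane, hint⟩ := h 1 one_pos blob blob_isSmoothSpaceTimeOn
    (fun t _ => blob_isDivFree t) (fun t ht => blob_hasCompactSupport ht.2)
    (fun t ht => blob_energy_lt_top ht.2) (fun s _ t ht hst => blob_energy_antitone ht.2 hst)
    blob_dissipation_lt_top blob_typeI blob_critical
  have he : 0 < 2 / (2 * q - 3) := div_pos two_pos (by linarith)
  have hq0 : 0 ≤ q := by linarith
  -- the threshold time `t₀`: for `t > t₀`, `λ(t) ≥ R := max (4l) 1`
  set R : ℝ := max (4 * l) 1 with hR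
  have hR1 : 1 ≤ R := le_max_right _ _
  have hR0 : 0 < R := by linarith
  set t₀ : ℝ := 1 - (R ^ 2)⁻¹ with ht₀
  have ht₀0 : 0 ≤ t₀ := by
    have : (R ^ 2)⁻¹ ≤ 1 := inv_le_one_of_one_le₀ (by nlinarith)
    linarith
  have ht₀1 : t₀ < 1 := by
    have : 0 < (R ^ 2)⁻¹ := by positivity
    linarith
  have hrate : ∀ t ∈ Ioo t₀ 1, R ≤ rate t := by
    intro t ht
    have h1t : 0 < 1 - t := by linarith [ht.2]
    have h2 : 1 - t ≤ (R ^ 2)⁻¹ := by linarith [ht.1]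
    have h3 : Real.sqrt (1 - t) ≤ R⁻¹ :=
      (Real.sqrt_le_sqrt h2).trans_eq (by rw [← inv_pow, Real.sqrt_sq (inv_nonneg.2 hR0.le)])
    calc R = (R⁻¹)⁻¹ := (inv_inv R).symm
      _ ≤ (Real.sqrt (1 - t))⁻¹ := inv_anti₀ (Real.sqrt_pos.2 h1t) h3
  -- the positive constant `K` and the pointwise lower bound `K/(1−t)` of the time integrand
  set K : ℝ≥0∞ := (ENNReal.ofReal ((4 : ℝ)⁻¹ ^ 3) * volume (ball (0 : EuclideanSpace ℝ (Fin 3)) 1)) ^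
    (2 / (2 * q - 3)) with hK
  have hB0 : ENNReal.ofReal ((4 : ℝ)⁻¹ ^ 3) * volume (ball (0 : EuclideanSpace ℝ (Fin 3)) 1) ≠ 0 :=
    mul_ne_zero (ENNReal.ofReal_pos.2 (by positivity)).ne' (measure_ball_pos volume _ one_pos).ne'
  have hBtop : ENNReal.ofReal ((4 : ℝ)⁻¹ ^ 3) * volume (ball (0 : EuclideanSpace ℝ (Fin 3)) 1) ≠ ⊤ :=
    ENNReal.mul_ne_top ENNReal.ofReal_ne_top measure_ball_lt_top.ne
  have hK0 : K ≠ 0 := (ENNReal.rpow_pos (pos_iff_ne_zero.2 hB0) hBtop).ne'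
  have hKtop : K ≠ ⊤ := ENNReal.rpow_ne_top_of_nonneg he.le hBtop
  have hG : ∀ t ∈ Ioo t₀ 1, ENNReal.ofReal ((1 - t)⁻¹) * K ≤
      (∫⁻ x in {x : EuclideanSpace ℝ (Fin 3) | l < ‖blob t x‖}, ENNReal.ofReal (m t x) ^ q) ^
        (2 / (2 * q - 3)) := by
    intro t ht
    have ht1 : t < 1 := ht.2
    have hc : 0 < rate t := rate_pos ht1
    have hcl : 4 * l ≤ rate t := (le_max_left _ _).trans (hrate t ht)
    have h1 := core_inner_lower hc hcl hq0 (μ := m t)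
      (fun y hy => hplane t ⟨ht₀0.trans ht.1.le, ht1⟩ y hy)
    have h2 := ENNReal.rpow_le_rpow h1 he.le
    rw [core_rpow_identity hc hq, rate_sq ht1] at h2
    exact h2
  -- integrate: `∫_{t₀}^1 K/(1−t) dt = ∞`
  have hI : ∫⁻ t in Ioo t₀ 1, ENNReal.ofReal ((1 - t)⁻¹) * K = ⊤ := by
    rw [lintegral_mul_const' _ _ hKtop, lintegral_inv_one_sub_eq_top ht₀1, ENNReal.top_mul hK0]
  have h3 := (setLIntegral_mono' measurableSet_Ioo hG).trans
    (lintegral_mono_set (μ := volume) (Ioo_subset_Ioo_left ht₀0))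
  rw [hI, top_le_iff] at h3
  exact (lt_top_iff_ne_top.1 hint) h3

end Summit.NavierStokesRegularity.NavierStokesRegularity.Theorems.FastClassSqueeze.Negative

end
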